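import Literature.AlgebraicGeometry.Frobenioids.AngularFrobenioids
import Literature.AlgebraicGeometry.Frobenioids.ArchimedeanRegionCalculus
import Literature.AlgebraicGeometry.Frobenioids.ArchimedeanConjugateArcs
import HarnessLib

/-!
# Frobenioids II, Proposition 3.4 (ii), condition (b): the Lemma 3.2 (ii) step — conjugate lifts
# (abc-iut cell, layer L1, node `FrdII:Prop3.4(ii)`, chain LC-L1-2; helper file)

Mochizuki, *The geometry of Frobenioids II: poly-Frobenioids*, Kyushu J. Math. **62** (2008)
401–460, §3, Proposition 3.4 (ii) p. 30, proof p. 30 ll. 30–38 [cite: MochizukiFrdII2008, Prop 3.4 (ii) p.30]: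

> "On the other hand, if `α_{D₀} ≠ β_{D₀}`, but condition (b) is satisfied, then it follows from [the
> latter portion of] Lemma 3.2, (ii), that there exist `α₀, β₀` as desired [linear isometries
> `C₀ → A₀` lifting `α_{D₀}, β_{D₀}` with `φ₀ ∘ α₀ = φ₀ ∘ β₀`], where `α₀` is related to `β₀` by an
> automorphism of `C₀` that lies over the complex conjugation automorphism of `C_{D₀}`."

PROVED here (proof-only, nothing defined), the three ingredients of that sentence at the level of
`C₀` and `O_ℂ^× = S¹`:
* `exists_inv_eq_smul_of_pow_eq_one` — Lemma 3.2 (ii), second sentence (tree: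
  `CircleOpens.ItemII_roots_holds`, seat abc-iut-L1-t7), direction "⇐", transported from Mathlib's
  `Circle` to `normOneSubgroup ℂ` along `ArchFrd.exists_unitCircleEquiv` (complex conjugation on
  `S¹` is inversion): a connected open `A ∋ p` with `pⁿ = 1` contains a connected open `A'` with
  `conj(A') = w · A'`, `wⁿ = 1`;
* `exists_inv_eq_smul_of_pow_eq` — its twisted form actually needed when the scalar `c_φ` of `φ₀`
  is not real: if `p ∈ A` with `p^{2d} = v^{-2}` then some connected open `A' ⊆ A` has
  `conj(A') = w · A'` with `w^d = v²` (apply the previous item to `p⁻¹ · A`);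
* `C0.exists_conj_pair` — given such `A' ⊆ B_X` and `w` with `conj(c_φ) · w^{deg φ} = c_φ`, the object
  `Z₀ = (Spec ℂ, A' × (0, tip X])` carries two linear isometries `a₀ = (id, 1, 1)`,
  `b₀ = (conj, 1, w) = σ̃ ∘ a₀` into `X` (complex) with `φ₀ ∘ a₀ = φ₀ ∘ b₀` for `φ₀ : X → Y`, `Y` real.
No side is taken on [IUTchIII] Cor. 3.12.
-/

namespace Literature.AlgebraicGeometry.Frobenioids

open CategoryTheory Set
open scoped Pointwise

noncomputable section

namespace ArchFrd

/-! ### The conjugate pair of linear isometric lifts in `C₀` -/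

namespace C0

/-- **Prop. 3.4 (ii), proof, condition (b)** (p. 30): over `Spec ℂ`, given a connected open
`A' ⊆ B_X` with `conj(A') = w · A'` and `conj(c_φ) · w^{deg φ} = c_φ` for `φ₀ : X → Y` with `X`
complex and `Y` real, the object `Z₀ = (Spec ℂ, A' × (0, tip X])` admits linear isometries
`a₀ = (id, 1, 1)` and `b₀ = (conj, 1, w)` into `X` — `b₀` is `a₀` precomposed with the automorphism
`(conj, 1, w)` of `Z₀` "that lies over the complex conjugation automorphism" — with
`φ₀ ∘ a₀ = φ₀ ∘ b₀`. [cite: MochizukiFrdII2008, Prop 3.4 (ii) p.30] -/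
theorem exists_conj_pair (RX : AngularRegion ℂ) (hRX : D0.complex = D0.real → RX.IsIsotropic)
    (RY : AngularRegion ℂ) (hRY : D0.real = D0.real → RY.IsIsotropic)
    (φ : C0.mk D0.complex RX hRX ⟶ C0.mk D0.real RY hRY)
    {A' : Set ↥(normOneSubgroup ℂ)} (hA'o : IsOpen A') (hA'c : IsConnected A') (hsub : A' ⊆ RX.dir)
    (w : ↥(normOneSubgroup ℂ)) (hconj : A'⁻¹ = w • A')
    (hw : D0.galAct true (scalar φ) * (w : ℂˣ) ^ (degFr φ : ℕ) = scalar φ) :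
    ∃ (RZ : AngularRegion ℂ) (hRZ : D0.complex = D0.real → RZ.IsIsotropic)
      (a b : C0.mk D0.complex RZ hRZ ⟶ C0.mk D0.complex RX hRX),
      Base a = 𝟙 D0.complex ∧ Base b = D0.conj ∧ degFr a = 1 ∧ degFr b = 1 ∧
        PreFrobenioid.IsIsometry toElem a ∧ PreFrobenioid.IsIsometry toElem b ∧ a ≫ φ = b ≫ φ := by
  obtain ⟨RZ, hdir, htip⟩ := exists_angularRegion hA'o hA'c RX.tip
  have hRZ : D0.complex = D0.real → RZ.IsIsotropic := fun h => by cases h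
  have hcarZ : RZ.carrier ⊆ RX.carrier := by
    intro u hu
    refine ⟨hsub ?_, ?_⟩
    · rw [← hdir]
      exact hu.1
    · rw [← htip]
      exact hu.2
  have hw1 : ‖((w : ℂˣ) : ℂ)‖ = 1 := (mem_normOneSubgroup_iff ℂ _).1 w.2
  have hma : (1 : ℂˣ) • (C0.mk D0.complex RZ hRZ).region.carrier ^ ((1 : ℕ+) : ℕ) ⊆
      pullRegion (C0.mk D0.complex RX hRX) (𝟙 D0.complex) := by
    rw [one_smul, PNat.one_coe, pow_one]
    show RZ.carrier ⊆ pullRegion (C0.mk D0.complex RX hRX) (𝟙 (C0.mk D0.complex RX hRX).base)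
    rw [pullRegion_id]
    exact hcarZ
  have hmb : (w : ℂˣ) • (C0.mk D0.complex RZ hRZ).region.carrier ^ ((1 : ℕ+) : ℕ) ⊆
      pullRegion (C0.mk D0.complex RX hRX) D0.conj := by
    rw [PNat.one_coe, pow_one]
    rintro _ ⟨u, hu, rfl⟩
    have hu1 : unitPart ℂ u ∈ A' := by
      rw [← hdir]
      exact hu.1
    have hu2 : absHom ℂ u ≤ RX.tip := by
      rw [← htip]
      exact hu.2
    refine ⟨D0.galAct true ((w : ℂˣ) * u), ⟨?_, ?_⟩, ?_⟩
    · show unitPart ℂ (D0.galAct true ((w : ℂˣ) * u)) ∈ RX.dir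
      rw [unitPart_galAct_true, unitPart_mul, unitPart_normOne_coe]
      apply hsub
      have : w * unitPart ℂ u ∈ w • A' := smul_mem_smul_set hu1
      rw [← hconj] at this
      exact this
    · show absHom ℂ (D0.galAct true ((w : ℂˣ) * u)) ≤ RX.tip
      rw [absHom_galAct, map_mul, absHom_coe_normOne, one_mul]
      exact hu2
    · show D0.galAct (D0.Hom.twists D0.conj) _ = _
      rw [D0.twists_conj, D0.galAct_galAct]
      rfl
  have hwmem : (w : ℂˣ) ∈ D0.scalars (C0.mk D0.complex RZ hRZ).base := by
    show (w : ℂˣ) ∈ D0.scalars D0.complex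
    rw [D0.scalars_complex]
    exact Subgroup.mem_top _
  refine ⟨RZ, hRZ, ⟨𝟙 D0.complex, 1, 1, one_mem _, hma⟩, ⟨D0.conj, 1, (w : ℂˣ), hwmem, hmb⟩,
    rfl, rfl, rfl, rfl, ?_, ?_, ?_⟩
  · rw [A0.isIsometry_iff_norm_mul_tip_pow]
    show ‖((1 : ℂˣ) : ℂ)‖ * (RZ.tip : ℝ) ^ ((1 : ℕ+) : ℕ) = (RX.tip : ℝ)
    rw [Units.val_one, norm_one, one_mul, PNat.one_coe, pow_one, htip]
  · rw [A0.isIsometry_iff_norm_mul_tip_pow]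
    show ‖((w : ℂˣ) : ℂ)‖ * (RZ.tip : ℝ) ^ ((1 : ℕ+) : ℕ) = (RX.tip : ℝ)
    rw [hw1, one_mul, PNat.one_coe, pow_one, htip]
  · refine C0.hom_ext (Subsingleton.elim _ _) rfl ?_
    show (𝟙 D0.complex : D0.complex ⟶ D0.complex).act (scalar φ) * (1 : ℂˣ) ^ (degFr φ : ℕ) =
      D0.conj.act (scalar φ) * (w : ℂˣ) ^ (degFr φ : ℕ)
    rw [one_pow, mul_one]
    show D0.galAct (D0.Hom.twists (𝟙 D0.complex)) (scalar φ) =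
      D0.galAct (D0.Hom.twists D0.conj) (scalar φ) * (w : ℂˣ) ^ (degFr φ : ℕ)
    rw [D0.twists_id, D0.twists_conj, D0.galAct_false, hw]

end C0

end ArchFrd

end

end Literature.AlgebraicGeometry.Frobenioids
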